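import Summits.QuantumFields.YangMills.Theorems.BalabanUVNodesN18KingModelTwoFactor
import Summits.QuantumFields.YangMills.Theorems.BalabanUVNodesN18KingModelTorusDeriv

/-!
# BalabanUVNodes ∕ N18 — King's Prop. 3.9 (3.73), SECOND entry (`∂^η_μ` on the first variable), FOR THE TOP-SCALE PIECE
# `G^η_{(K)} = C^η − G^η_K`, as a MULTI-SCALE inhabitant of `T4OutputRate.NE5` for King's ACTUAL operators on Bałaban's tori,
# UNCONDITIONAL — n18-b's files 14b∕14c (`covQstar_kernel_decay_blocks`, `covQstar_row_rate`) and 10 (`dminimiser_row_decay`,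
# `dminimiser_row_rate`) consumed BY NAME through the two-factor knit `N18KingModelTwoFactor` (Track A, DAG node N18 = NE5
# `T4OutputRate.NE5 EA EB W κ θ C₅` :211; cluster K4; the -a∕-b loop on the PRINTED MODEL, seventh display)

HONEST FRAMING.  Count-neutral kernel bookkeeping (seat pub-ymgap-dag-n18-a g5; `--supports stmt-QuantumFields-19182`).
King's A = 0 scalar MODEL of the NE5 mechanism (template literature, published and proved) — NOT Bałaban's covariant
one-step outputs `E^{(j)}(X; g, U)`, for which NE5 is NOT IN PRINT and has no tree producer (NODE O 0∕1); NOT a node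
discharge; finite tori; nothing continuum ∕ ℝ⁴ ∕ OS ∕ mass-gap ∕ Clay.  THEOREMS ONLY: 0 `def`, 0 `sorry`, standard axioms.

THE POINT.  King p. 675: «Finally, Proposition 3.9 holds for G^η_{(K)} from the convergence of C^ηQ^*_K and a_KQ_KG^η_K,
and the scalings of the operators»; (3.73), second entry: «|∂^{η′}_μG^{η′}_{(j)}(x′, y′) − ∂^η_μG^η_{(j)}(x, y)| ≦ CL^{−γk}(L^jη)^{1−d−γ}
exp[−δ₀(L^jη)^{−1}|x − y|]».  By the symmetry of `G^η_{(K)}` (`N18KingModelTwoFactor.topPiece_symm`) the lattice derivative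
in the first variable lands on the MINIMISER factor of (4.44): `L^K(G^η_{(K)}(x + e_μ, y) − G^η_{(K)}(x, y)) =
Σ_b C^ηQ^*_K(y, b)·∂^η_μℋ_K(x, b)` (`dtopPiece_eq_sum`), a TWO-factor graph whose row `C^ηQ^*_K(y, ·)` is n18-b's 14b∕14c
(decay from `B(y)`, two-spacing rate with the extra additive `c(L^K)⁻¹`) and whose column `∂^η_μℋ_K(x, ·)` is file 10
(Theorem 3.3's derivative clause and (3.71) line 2 in block currency):
* §1 **`ne5_kingModel_topPieceDeriv_torus`** — for `d ≥ 1`, odd `L > 1`, `a > 0`, `m² > 0`, `0 ≤ γ < 1`: `∃ κ > 0, C₅ ≥ 0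
  (d, L, a, m², γ only) ∀ n ≥ 1 ∀ scale-indexed Bałaban tori ∀ carriers (scale X = K ≥ 1; a direction μ(X); fine points
  x_A, y_A under x_B, y_B; d X ≤ |B(x_A) − B(y_A)|_{T₁}) ∀ read-outs EA = L^K(G^η_{(K)}(x_A + e_μ, y_A) − G^η_{(K)}(x_A, y_A)),
  EB = the (K, n)-refined one ∀ W, NE5 EA EB W κ (L^{−γ∕2}) C₅` — UNCONDITIONAL, ONE θ for all K; composition
  `ne5_of_twoFactorRates_torus` with `hu` ≔ `covQstar_kernel_decay_blocks`, `hdu` ≔ `covQstar_row_rate` ∘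
  `N18KingModelTopPiece.topRate_le_unif`, `hv` ≔ `dminimiser_row_decay`, `hdv` ≔ `dminimiser_row_rate` ∘
  `N18KingModelTorusDeriv.douterRate_le_unif`, rates `δ₁ = min(δ^{14b}, δ^{14c})`, `δ₂ = min(δ₀^{∂}, δ₀^{∂,rate}∕2)`,
  `κ = min(δ₁, δ₂)∕2`.
* §2 `ne5_kingModel_topPieceDeriv_inhabited` — §1 on LITERAL carriers (`d X` = the block distance).
With `N18KingModelTopPiece` (p424672) this gives BOTH entries of (3.73) for the top piece; its (3.75) entries are the sibling
`BalabanUVNodesN18KingModelTopPieceHolder`.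
NOT COVERED ∕ PINS (standing, ref-B READ #66∕#73∕#110∕#238∕#263): A = 0, `g`∕`U` unread; periodic b.c.; King's rescaling
(2.20) and the power `(L^jη)^{1−d−γ}`; the `t`-derivative clauses via `m²(t)`; the bearing on Bałaban's `E^{(j)}(X; g, U)` is
NIL (NODE O + rows NE2∕NE3, seat README «No tree producer»).

Sources: C. King, Commun. Math. Phys. **102** (1986) 649–677 [King1986] — p. 675 (4.44)–(4.45), Prop. 3.9 (3.73) p. 665,
Prop. 3.8 (3.71) p. 664, Prop. 3.7 (3.64) p. 663, Thm 3.3 p. 658; T. Bałaban, Commun. Math. Phys. **109** (1987) 249–301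
[Balaban1987RG1] — (0.25) p. 257, Thm 1 p. 259 (uniformity in ε, the only printed trace of NE5).  No claim about the mass gap.
-/

noncomputable section

namespace Summit.QuantumFields.YangMills.BalabanUVNodes.N18KingModelTopPieceDeriv

open Real Matrix
open Literature.MathematicalPhysics.QuantumFieldTheory.Balaban1983to89 (Params)
open Literature.MathematicalPhysics.QuantumFieldTheory.Balaban1983to89.T4OutputRate (Carriers Functional NE5)
open Literature.MathematicalPhysics.QuantumFieldTheory.Balaban1983to89.B5Prop11Plancherel (Tor fine unitVec)
open Literature.MathematicalPhysics.QuantumFieldTheory.Balaban1983to89.B4Sect5Proof (latticeConst latticeConst_nonneg)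
open Literature.MathematicalPhysics.QuantumFieldTheory.King1986
  (aK aK_pos lemma43Const prop38RateConst prop38PosConst dprop38RateConst dprop38PosConst exp_decay_mono)
open Literature.MathematicalPhysics.QuantumFieldTheory.King1986.Torus
  (topPiece covQstar minimiser blockOf blockOf_over tdistT tdistT_symm tdistT_nonneg covQstar_kernel_decay_blocks
    covQstar_row_rate dminimiser_row_decay dminimiser_row_rate)
open Summit.QuantumFields.YangMills.BalabanUVNodes.N18KingModel (prop38Const_unif_nonneg kingTheta_pos coarse_val)
open Summit.QuantumFields.YangMills.BalabanUVNodes.N18KingModelTorusDeriv (douterRate_le_unif)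
open Summit.QuantumFields.YangMills.BalabanUVNodes.N18KingModelTopPiece (topRate_le_unif)
open Summit.QuantumFields.YangMills.BalabanUVNodes.N18KingModelTwoFactor (ne5_of_twoFactorRates_torus dtopPiece_eq_sum)

variable {d : ℕ}

/-! ## §1 (3.73), second entry, for the top piece, on Bałaban's tori: both factors BY NAME -/

/-- **KING'S (3.73), SECOND ENTRY, FOR THE TOP-SCALE PIECE `G^η_{(K)}` AS A MULTI-SCALE INHABITANT OF N18's DECL OF RECORD —
UNCONDITIONAL FOR KING'S ACTUAL OPERATORS ON BAŁABAN'S TORI.**  For `d ≥ 1`, odd `L > 1`, `a > 0`, `m² > 0`, `0 ≤ γ < 1` there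
are `κ > 0`, `C₅ ≥ 0` (functions of `d, L, a, m², γ` only) such that: for every `n ≥ 1`; every scale-indexed family of
Bałaban unit tori `L·M_K(μ) = 2L^{m_K}`; every carriers `C` with `1 ≤ scale X` whose domain `X` of scale `K` reads a
direction `μ(X)` and fine points `x_A(X)`, `y_A(X)` UNDER `x_B(X)`, `y_B(X)`, with tree length `≤ |B(x_A) − B(y_A)|_{T₁}`; every
two functionals reading the DERIVATIVE of the top piece in the first variable — run A
`∂^η_μG^η_{(K)}(x_A, y_A) = L^K·(topPiece (L^K) T₁ a_K L^{2K} m² (x_A + e_μ) y_A − topPiece … x_A y_A)`, run B the (K, n)-refined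
one — King's ACTUAL `A = 0` operators; every window: `NE5 EA EB W κ (L^{−γ∕2}) C₅`.
[cite: King1986, p.675 (4.44)–(4.45), Prop. 3.9 (3.73) p.665, Prop. 3.8 (3.71) p.664, Thm 3.3 (3.7) p.658] -/
theorem ne5_kingModel_topPieceDeriv_torus (hd : 1 ≤ d) (L : ℕ) [NeZero L] (hLp : Odd L ∧ 1 < L) {a m2 : ℝ}
    (ha : 0 < a) (hm : 0 < m2) {γ : ℝ} (hγ0 : 0 ≤ γ) (hγ1 : γ < 1) :
    ∃ κ C₅ : ℝ, 0 < κ ∧ 0 ≤ C₅ ∧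
      ∀ (n : ℕ) (_hn : 1 ≤ n) (M : ℕ → Fin d → ℕ) [∀ j μ, NeZero (M j μ)]
        (_hM : ∀ j, ∃ mm : ℕ, ∀ μ, L * M j μ = 2 * L ^ mm)
        (C : Carriers) (_hsc : ∀ X, 1 ≤ C.scale X) (dir : C.Dom → Fin d)
        (xA yA : (X : C.Dom) → Tor (fine (L ^ C.scale X) (fine L (M (C.scale X)))))
        (xB yB : (X : C.Dom) → Tor (fine (L ^ n * L ^ C.scale X) (fine L (M (C.scale X)))))
        (_hx : ∀ X μ, (xA X μ).val = (xB X μ).val / L ^ n)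
        (_hy : ∀ X μ, (yA X μ).val = (yB X μ).val / L ^ n)
        (_hd : ∀ X, C.d X ≤ tdistT (fine L (M (C.scale X)))
            (blockOf (L ^ C.scale X) (fine L (M (C.scale X))) (xA X))
            (blockOf (L ^ C.scale X) (fine L (M (C.scale X))) (yA X)))
        (EA : Functional C C.BgA) (EB : Functional C C.BgB)
        (_hEA : ∀ g U X, EA g U X =
          ((L ^ C.scale X : ℕ) : ℝ)
            * (topPiece (L ^ C.scale X) (fine L (M (C.scale X))) (aK a L (C.scale X)) (((L ^ C.scale X : ℕ) : ℝ) ^ 2) m2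
                  (xA X + unitVec (fine (L ^ C.scale X) (fine L (M (C.scale X)))) (dir X)) (yA X)
              - topPiece (L ^ C.scale X) (fine L (M (C.scale X))) (aK a L (C.scale X)) (((L ^ C.scale X : ℕ) : ℝ) ^ 2) m2
                  (xA X) (yA X)))
        (_hEB : ∀ g U X, EB g U X =
          ((L ^ n * L ^ C.scale X : ℕ) : ℝ)
            * (topPiece (L ^ n * L ^ C.scale X) (fine L (M (C.scale X))) (aK a L (C.scale X + n))
                  (((L ^ n * L ^ C.scale X : ℕ) : ℝ) ^ 2) m2
                  (xB X + unitVec (fine (L ^ n * L ^ C.scale X) (fine L (M (C.scale X)))) (dir X)) (yB X)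
              - topPiece (L ^ n * L ^ C.scale X) (fine L (M (C.scale X))) (aK a L (C.scale X + n))
                  (((L ^ n * L ^ C.scale X : ℕ) : ℝ) ^ 2) m2 (xB X) (yB X)))
        (W : Set (ℕ → ℝ)),
        NE5 EA EB W κ ((L : ℝ) ^ (-(γ / 2))) C₅ := by
  have hd0 : 0 < d := hd
  have hL2 : 2 ≤ L := by have := hLp.2; omega
  have hLr : (1 : ℝ) < L := by exact_mod_cast hLp.2
  have hγ1' : γ ≤ 1 := hγ1.le
  -- the four one-line packages of n18-b, BY NAME: the `C^ηQ^*_K` row (14b∕14c), the derivative column (file 10)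
  obtain ⟨δb, cb, hδb, hcb, Hb⟩ := covQstar_kernel_decay_blocks d L hd hLp.1 hL2 ha hm
  obtain ⟨δc, cc, hδc, hcc, Hc⟩ := covQstar_row_rate d L hd hLp.1 hL2 ha hm hγ0 hγ1'
  obtain ⟨δ₀, c₀, hδ₀, hc₀, H₀⟩ := dminimiser_row_decay d L hd hLp ha hm.le
  obtain ⟨δ₃, c₃, hδ₃, hc₃, H₃⟩ := dminimiser_row_rate d L hd hLp.1 hL2 ha hm hγ0 hγ1
  -- common rates: `δ₁` for the rows, `δ₂` for the columns, `δ = min(δ₁, δ₂)∕2` for the conclusion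
  set δ₁ : ℝ := min δb δc with hδ₁
  set δ₂ : ℝ := min δ₀ (δ₃ / 2) with hδ₂
  have hδ₁pos : 0 < δ₁ := lt_min hδb hδc
  have hδ₂pos : 0 < δ₂ := lt_min hδ₀ (half_pos hδ₃)
  have hδ₁b : δ₁ ≤ δb := min_le_left _ _
  have hδ₁c : δ₁ ≤ δc := min_le_right _ _
  have hδ₂₀ : δ₂ ≤ δ₀ := min_le_left _ _
  have hδ₂₃ : δ₂ ≤ δ₃ / 2 := min_le_right _ _
  set δ : ℝ := min δ₁ δ₂ / 2 with hδ
  have hδpos : 0 < δ := half_pos (lt_min hδ₁pos hδ₂pos)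
  have hδA : 2 * δ ≤ δ₁ := by rw [hδ]; linarith [min_le_left δ₁ δ₂]
  have hδB : 2 * δ ≤ δ₂ := by rw [hδ]; linarith [min_le_right δ₁ δ₂]
  -- the uniform letters
  set Cu : ℝ := prop38RateConst a a (a * (2 * ((a * (1 - ((L : ℝ) ^ 2)⁻¹))⁻¹ + π ^ 2 / 48 + 1 / 3)))
      ((π ^ 2 / 4) ^ d) d γ + prop38PosConst a ((π ^ 2 / 4) ^ d) d γ with hCu
  set Cu' : ℝ := dprop38RateConst a a (a * (2 * ((a * (1 - ((L : ℝ) ^ 2)⁻¹))⁻¹ + π ^ 2 / 48 + 1 / 3)))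
      ((π ^ 2 / 4) ^ d) d γ + dprop38PosConst a ((π ^ 2 / 4) ^ d) d γ with hCu'
  have hCu0 : 0 ≤ Cu := prop38Const_unif_nonneg hd0 ha hL2 (by linarith : γ < 2)
  set cA : ℝ := cc * Real.sqrt Cu + cc with hcA
  set cB : ℝ := Real.sqrt (2 * (a * c₃) * Cu') with hcB
  have hcA0 : 0 ≤ cA := by positivity
  have hcB0 : 0 ≤ cB := Real.sqrt_nonneg _
  have hθ : 0 ≤ (L : ℝ) ^ (-(γ / 2)) := (kingTheta_pos (by omega) _).le
  have hKd : 0 ≤ latticeConst d δ := latticeConst_nonneg d hδpos.le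
  refine ⟨δ, (cA * (a * c₀) + cb * cB) * latticeConst d δ, hδpos, by positivity, ?_⟩
  intro n hn M _ hM C hsc dir xA yA xB yB hx hy hdd EA EB hEA hEB W
  refine ne5_of_twoFactorRates_torus (C := C) (EA := EA) (EB := EB) (W := W) L M
    (fun X => blockOf (L ^ C.scale X) (fine L (M (C.scale X))) (yA X))
    (fun X => blockOf (L ^ C.scale X) (fine L (M (C.scale X))) (xA X))
    (fun X b => covQstar (L ^ C.scale X) (fine L (M (C.scale X))) (((L ^ C.scale X : ℕ) : ℝ) ^ 2) m2
      (Pi.single b 1) (yA X))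
    (fun X b => covQstar (L ^ n * L ^ C.scale X) (fine L (M (C.scale X))) (((L ^ n * L ^ C.scale X : ℕ) : ℝ) ^ 2) m2
      (Pi.single b 1) (yB X))
    (fun X b => ((L ^ C.scale X : ℕ) : ℝ)
      * (minimiser (L ^ C.scale X) (fine L (M (C.scale X))) (aK a L (C.scale X)) (((L ^ C.scale X : ℕ) : ℝ) ^ 2) m2
            (Pi.single b 1) (xA X + unitVec (fine (L ^ C.scale X) (fine L (M (C.scale X)))) (dir X))
          - minimiser (L ^ C.scale X) (fine L (M (C.scale X))) (aK a L (C.scale X)) (((L ^ C.scale X : ℕ) : ℝ) ^ 2) m2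
            (Pi.single b 1) (xA X)))
    (fun X b => ((L ^ n * L ^ C.scale X : ℕ) : ℝ)
      * (minimiser (L ^ n * L ^ C.scale X) (fine L (M (C.scale X))) (aK a L (C.scale X + n))
            (((L ^ n * L ^ C.scale X : ℕ) : ℝ) ^ 2) m2 (Pi.single b 1)
            (xB X + unitVec (fine (L ^ n * L ^ C.scale X) (fine L (M (C.scale X)))) (dir X))
          - minimiser (L ^ n * L ^ C.scale X) (fine L (M (C.scale X))) (aK a L (C.scale X + n))
            (((L ^ n * L ^ C.scale X : ℕ) : ℝ) ^ 2) m2 (Pi.single b 1) (xB X)))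
    hδpos hδA hδB hθ hcb.le (by positivity : 0 ≤ a * c₀) hcA0 hcB0 ?_ ?_ ?_ ?_ ?_ ?_ ?_
  · -- `hu`: the `C^ηQ^*_K` row of run A at `y_A`, Prop. 3.7 in block currency (`covQstar_kernel_decay_blocks`, 14b)
    intro X b
    obtain ⟨mm, hmm⟩ := hM (C.scale X)
    have hMK : ∀ μ, fine L (M (C.scale X)) μ
        = (⟨d, L, mm, C.scale X, hd, hLp⟩ : Params).sitesPerDir (C.scale X) := fun μ => by
      simp only [Params.sitesPerDir, Nat.add_sub_cancel]; exact hmm μ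
    have h := Hb ⟨d, L, mm, C.scale X, hd, hLp⟩ rfl rfl (hsc X) (fine L (M (C.scale X))) hMK (L ^ C.scale X) rfl
      (yA X) b
    exact h.trans (exp_decay_mono hcb.le hδ₁b (tdistT_nonneg _ _ _))
  · -- `hv`: the derivative column of run B at `x_B` (`dminimiser_row_decay`, file 10), the block under `x_B` is `B(x_A)`
    intro X b
    obtain ⟨mm, hmm⟩ := hM (C.scale X)
    have hMK : ∀ μ, fine L (M (C.scale X)) μ
        = (⟨d, L, mm, C.scale X + n, hd, hLp⟩ : Params).sitesPerDir (C.scale X + n) := fun μ => by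
      simp only [Params.sitesPerDir, Nat.add_sub_cancel]; exact hmm μ
    have hN : L ^ n * L ^ C.scale X = L ^ (C.scale X + n) := by rw [pow_add, mul_comm]
    have h := H₀ ⟨d, L, mm, C.scale X + n, hd, hLp⟩ rfl rfl (show 1 ≤ C.scale X + n by have := hsc X; omega)
      (fine L (M (C.scale X))) hMK (L ^ n * L ^ C.scale X) hN δ₂ hδ₂pos hδ₂₀ (xB X) b (dir X)
    rw [blockOf_over (fine L (M (C.scale X))) (xA X) (xB X) (hx X)] at h
    exact h
  · -- `hdu`: the `C^ηQ^*_K` row difference (`covQstar_row_rate`, 14c), constant made `K, n`-free by `topRate_le_unif`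
    intro X b
    obtain ⟨mm, hmm⟩ := hM (C.scale X)
    have hMK : ∀ μ, fine L (M (C.scale X)) μ
        = (⟨d, L, mm, C.scale X, hd, hLp⟩ : Params).sitesPerDir (C.scale X) := fun μ => by
      simp only [Params.sitesPerDir, Nat.add_sub_cancel]; exact hmm μ
    haveI : NeZero (⟨d, L, mm, C.scale X, hd, hLp⟩ : Params).L := ‹NeZero L›
    have h := Hc ⟨d, L, mm, C.scale X, hd, hLp⟩ rfl rfl (hsc X) n hn (fine L (M (C.scale X))) hMK
      (yA X) (yB X) b (hy X)
    refine (h.trans (exp_decay_mono (by positivity) hδ₁c (tdistT_nonneg _ _ _))).trans ?_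
    exact mul_le_mul_of_nonneg_right (topRate_le_unif hd0 ha hL2 (hsc X) hn hγ1' hcc.le (K := C.scale X) (n := n))
      (Real.exp_pos _).le
  · -- `hdv`: the derivative column difference ((3.71) line 2, `dminimiser_row_rate`) + `douterRate_le_unif`
    intro X b
    obtain ⟨mm, hmm⟩ := hM (C.scale X)
    have hMK : ∀ μ, fine L (M (C.scale X)) μ
        = (⟨d, L, mm, C.scale X, hd, hLp⟩ : Params).sitesPerDir (C.scale X) := fun μ => by
      simp only [Params.sitesPerDir, Nat.add_sub_cancel]; exact hmm μ
    haveI : NeZero (⟨d, L, mm, C.scale X, hd, hLp⟩ : Params).L := ‹NeZero L›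
    have h := H₃ ⟨d, L, mm, C.scale X, hd, hLp⟩ rfl rfl (hsc X) n hn (fine L (M (C.scale X))) hMK δ₂ hδ₂pos hδ₂₃
      (xA X) (xB X) b (hx X) (dir X)
    exact h.trans (mul_le_mul_of_nonneg_right (douterRate_le_unif hd0 ha hL2 (hsc X) hn hγ1 hc₃.le)
      (Real.exp_pos _).le)
  · -- `hd`: King's `|x − y|` is symmetric
    intro X
    exact (hdd X).trans (le_of_eq (tdistT_symm _ _ _))
  · -- `hEA`: King's object IS the two-factor kernel (`dtopPiece_eq_sum`: symmetry of `G^η_{(K)}` + (4.44))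
    intro g U X
    rw [hEA]
    exact dtopPiece_eq_sum (L ^ C.scale X) (fine L (M (C.scale X))) (aK_pos ha hLr (hsc X)).le (by positivity) hm _ _ _ _
  · intro g U X
    rw [hEB]
    exact dtopPiece_eq_sum (L ^ n * L ^ C.scale X) (fine L (M (C.scale X)))
      (aK_pos ha hLr (show 1 ≤ C.scale X + n by have := hsc X; omega)).le (by positivity) hm _ _ _ _

/-! ## §2 A LITERAL inhabitant: the derivative of the top piece on King's own carriers -/

/-- **§1 INHABITED IN THE KERNEL WITH `d X` = THE ACTUAL BLOCK DISTANCE.**  On the LITERAL carriers whose domains are a number of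
steps `K` (creation scale `K + 1`), a direction `μ` and a pair of run-B fine points `x′, y′`, with `d X := |B(x) − B(y)|_{T₁}`
for the run-A points `x, y` under `x′, y′`, trivial backgrounds, transport `id`, gauge `0`, the functionals reading
`∂^η_μG^η_{(K+1)}(x, y)` and `∂^{η′}_μG^{η′}_{(K+1),(n)}(x′, y′)` satisfy `NE5 … κ (L^{−γ∕2}) C₅` with §1's letters for every `n ≥ 1`,
every Bałaban unit torus `L·M′(μ) = 2L^{m}` and every window (`hx`, `hy` ≔ `coarse_val`, `hd` ≔ `le_rfl`, `hEA`, `hEB` ≔ `rfl`).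
[cite: King1986, p.675 (4.44), Prop. 3.9 (3.73) p.665] -/
theorem ne5_kingModel_topPieceDeriv_inhabited (hd : 1 ≤ d) (L : ℕ) [NeZero L] (hLp : Odd L ∧ 1 < L) {a m2 : ℝ}
    (ha : 0 < a) (hm : 0 < m2) {γ : ℝ} (hγ0 : 0 ≤ γ) (hγ1 : γ < 1) :
    ∃ κ C₅ : ℝ, 0 < κ ∧ 0 ≤ C₅ ∧
      ∀ (n : ℕ) (_hn : 1 ≤ n) (M' : Fin d → ℕ) [∀ μ, NeZero (M' μ)] (_hM' : ∃ mm : ℕ, ∀ μ, L * M' μ = 2 * L ^ mm)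
        (W : Set (ℕ → ℝ)),
        NE5 (C := { Dom := Σ K : ℕ, Fin d × (Tor (fine (L ^ n * L ^ (K + 1)) (fine L M'))
                                           × Tor (fine (L ^ n * L ^ (K + 1)) (fine L M'))),
                    scale := fun X => X.1 + 1,
                    d := fun X => tdistT (fine L M')
                      (blockOf (L ^ (X.1 + 1)) (fine L M')
                        (fun μ => (((X.2.2.1 μ).val / L ^ n : ℕ) : ZMod (fine (L ^ (X.1 + 1)) (fine L M') μ))))
                      (blockOf (L ^ (X.1 + 1)) (fine L M')
                        (fun μ => (((X.2.2.2 μ).val / L ^ n : ℕ) : ZMod (fine (L ^ (X.1 + 1)) (fine L M') μ)))),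
                    d_nonneg := fun _ => tdistT_nonneg _ _ _,
                    BgA := PUnit, BgB := PUnit, gauge := fun _ _ => 0, gauge_nonneg := fun _ _ => le_rfl,
                    transport := id })
          (fun (_ : ℕ → ℝ) (_ : PUnit)
              (X : Σ K : ℕ, Fin d × (Tor (fine (L ^ n * L ^ (K + 1)) (fine L M'))
                                     × Tor (fine (L ^ n * L ^ (K + 1)) (fine L M')))) =>
            ((L ^ (X.1 + 1) : ℕ) : ℝ)
              * (topPiece (L ^ (X.1 + 1)) (fine L M') (aK a L (X.1 + 1)) (((L ^ (X.1 + 1) : ℕ) : ℝ) ^ 2) m2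
                    ((fun μ => (((X.2.2.1 μ).val / L ^ n : ℕ) : ZMod (fine (L ^ (X.1 + 1)) (fine L M') μ)))
                      + unitVec (fine (L ^ (X.1 + 1)) (fine L M')) X.2.1)
                    (fun μ => (((X.2.2.2 μ).val / L ^ n : ℕ) : ZMod (fine (L ^ (X.1 + 1)) (fine L M') μ)))
                - topPiece (L ^ (X.1 + 1)) (fine L M') (aK a L (X.1 + 1)) (((L ^ (X.1 + 1) : ℕ) : ℝ) ^ 2) m2
                    (fun μ => (((X.2.2.1 μ).val / L ^ n : ℕ) : ZMod (fine (L ^ (X.1 + 1)) (fine L M') μ)))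
                    (fun μ => (((X.2.2.2 μ).val / L ^ n : ℕ) : ZMod (fine (L ^ (X.1 + 1)) (fine L M') μ)))))
          (fun (_ : ℕ → ℝ) (_ : PUnit)
              (X : Σ K : ℕ, Fin d × (Tor (fine (L ^ n * L ^ (K + 1)) (fine L M'))
                                     × Tor (fine (L ^ n * L ^ (K + 1)) (fine L M')))) =>
            ((L ^ n * L ^ (X.1 + 1) : ℕ) : ℝ)
              * (topPiece (L ^ n * L ^ (X.1 + 1)) (fine L M') (aK a L (X.1 + 1 + n))
                    (((L ^ n * L ^ (X.1 + 1) : ℕ) : ℝ) ^ 2) m2 (X.2.2.1 + unitVec (fine (L ^ n * L ^ (X.1 + 1)) (fine L M')) X.2.1)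
                    X.2.2.2
                - topPiece (L ^ n * L ^ (X.1 + 1)) (fine L M') (aK a L (X.1 + 1 + n))
                    (((L ^ n * L ^ (X.1 + 1) : ℕ) : ℝ) ^ 2) m2 X.2.2.1 X.2.2.2))
          W κ ((L : ℝ) ^ (-(γ / 2))) C₅ := by
  obtain ⟨κ, C₅, hκ, hC₅, H⟩ := ne5_kingModel_topPieceDeriv_torus hd L hLp ha hm hγ0 hγ1
  refine ⟨κ, C₅, hκ, hC₅, ?_⟩
  intro n hn M' _ hM' W
  have hLn : 0 < L ^ n := pow_pos (Nat.pos_of_ne_zero (NeZero.ne L)) n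
  -- the carriers literal is repeated so that the reading maps elaborate against a closed structure
  exact H n hn (fun _ => M') (fun _ => hM')
    { Dom := Σ K : ℕ, Fin d × (Tor (fine (L ^ n * L ^ (K + 1)) (fine L M'))
                             × Tor (fine (L ^ n * L ^ (K + 1)) (fine L M'))),
      scale := fun X => X.1 + 1,
      d := fun X => tdistT (fine L M')
        (blockOf (L ^ (X.1 + 1)) (fine L M')
          (fun μ => (((X.2.2.1 μ).val / L ^ n : ℕ) : ZMod (fine (L ^ (X.1 + 1)) (fine L M') μ))))
        (blockOf (L ^ (X.1 + 1)) (fine L M')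
          (fun μ => (((X.2.2.2 μ).val / L ^ n : ℕ) : ZMod (fine (L ^ (X.1 + 1)) (fine L M') μ)))),
      d_nonneg := fun _ => tdistT_nonneg _ _ _,
      BgA := PUnit, BgB := PUnit, gauge := fun _ _ => 0, gauge_nonneg := fun _ _ => le_rfl, transport := id }
    (fun _ => Nat.succ_le_succ (Nat.zero_le _)) (fun X => X.2.1)
    (fun X μ => (((X.2.2.1 μ).val / L ^ n : ℕ) : ZMod (fine (L ^ (X.1 + 1)) (fine L M') μ)))
    (fun X μ => (((X.2.2.2 μ).val / L ^ n : ℕ) : ZMod (fine (L ^ (X.1 + 1)) (fine L M') μ)))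
    (fun X => X.2.2.1) (fun X => X.2.2.2)
    (fun X μ => coarse_val hLn X.2.2.1 μ) (fun X μ => coarse_val hLn X.2.2.2 μ)
    (fun _ => le_rfl) _ _ (fun _ _ _ => rfl) (fun _ _ _ => rfl) W

end Summit.QuantumFields.YangMills.BalabanUVNodes.N18KingModelTopPieceDeriv

end
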